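import Literature.NumberTheory.Automorphic.TameLevelScalarFactorisation
import Literature.NumberTheory.Automorphic.IwasawaDecompositionAdelic
import HarnessLib

/-!
# The Borel subgroup model at the good places: `H_S = {g ∈ GL_n(𝔸_K^∞) : g_v ∈ B(K_v) ∀ v ∉ S}`

Topic `NumberTheory/Automorphic`; namespace `Literature.NumberTheory.Automorphic`, grouping
sub-namespace `BigHeckeGLn` (the finite-adelic `GL_n` of `CompletedCohomologyHeckeAlgebraGLn`).

For a set `S` of finite places of the number field `K` let
`H_S ≤ 𝒢 = GL_n(𝔸_K^∞)` (`borelAwayFrom S`) be the subgroup of elements whose local components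
OUTSIDE `S` are upper triangular.  Proved here:

* `globalEmbedding_mem_borelAwayFrom` — `B(K) ↪ H_S` diagonally; `ofLocal_mem_borelAwayFrom`,
  `mem_borelAwayFrom_of_blockTriangular` (`B(𝔸_K^∞) ≤ H_S`);
* `exists_borelAwayFrom_mul_eq` — **`H_S · U = 𝒢`** for every level `U` containing the integral
  elements trivial at `S` (`∀ k ∈ GL_n(𝒪̂_K), (k_v = 1 ∀ v ∈ S) → k ∈ U`; e.g. `U = U_S × ∏_{v∉S} GL_n(𝒪_v)`):
  by the finite-adelic Iwasawa decomposition `g = b k` (tree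
  `exists_blockTriangular_mul_mem_glFiniteIntegralLevel`) and the splitting `k = k_S k^S` of an
  integral element into its parts at and away from `S` (`finiteGLOf`);
* `isUnramifiedLevel_borelAwayFrom` — at a place `w ∉ S` where `U` is unramified
  (`IsUnramifiedLevel GL_n(𝒪_w) ι_w (·)_w U`), the pair `(H_S, U ∩ H_S)` is unramified for the
  LOCAL BOREL: `IsUnramifiedLevel (B(K_w) ∩ GL_n(𝒪_w)) ι_w (·)_w (U ∩ H_S)` with
  `ι_w : B(K_w) → H_S`, `(·)_w : H_S → B(K_w)` (`ofBorelLocal`, `toBorelLocal`), so that the tree's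
  local–global coset correspondence `ArithmeticQuotient.IsUnramifiedLevel.bijOn_localCoset`
  computes the Hecke operators of `H_S` at `w` inside `B(K_w)`.

With `TwistedQuotientSubgroupModel` (`H_S · U = 𝒢` makes restriction to `H_S` an isomorphism
`Fun(𝒢/U, V) ≅ Fun(H_S/(U ∩ H_S), V)` of `B(K)`-representations) this is the model in which the
Hecke operators on the cohomology of the Borel stratum are computed [Harder1987, §2].

## References

* G. Harder, *Eisenstein cohomology of arithmetic groups. The case GL₂*, Invent. Math. 89 (1987), §2
  [Harder1987].
* J. R. Getz, H. Hahn, *An Introduction to Automorphic Representations* (2024), Thm. 2.7.1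
  [GetzHahn2024].
-/

noncomputable section

open scoped NumberField
open IsDedekindDomain

namespace Literature.NumberTheory.Automorphic

namespace BigHeckeGLn

variable {n : ℕ} {K : Type} [Field K] [NumberField K]

/-! ### The subgroup `H_S` -/

/-- **`H_S`**: the elements of `GL_n(𝔸_K^∞)` whose local components at the places OUTSIDE `S` lie
in the upper triangular Borel subgroup `B(K_v)` (`standardParabolicGL (K_v) id`). [cite: Harder1987, §2] -/
def borelAwayFrom (S : Set (HeightOneSpectrum (𝓞 K))) : Subgroup (FiniteAdelicGL n K) :=
  ⨅ (v : HeightOneSpectrum (𝓞 K)) (_ : v ∉ S),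
    (standardParabolicGL (v.adicCompletion K) (id : Fin n → Fin n)).comap (localComponent n K v)

/-- Membership in `H_S`. [folklore] -/
theorem mem_borelAwayFrom_iff {S : Set (HeightOneSpectrum (𝓞 K))} {g : FiniteAdelicGL n K} :
    g ∈ borelAwayFrom S ↔ ∀ v, v ∉ S →
      localComponent n K v g ∈ standardParabolicGL (v.adicCompletion K) (id : Fin n → Fin n) := by
  simp only [borelAwayFrom, Subgroup.mem_iInf, Subgroup.mem_comap]

/-- The local component of a principal element is the matrix mapped along `K → K_v`. [folklore] -/
theorem localComponent_globalEmbedding (v : HeightOneSpectrum (𝓞 K)) (γ : GL (Fin n) K) :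
    localComponent n K v (globalEmbedding n K γ) =
      Matrix.GeneralLinearGroup.map (algebraMap K (v.adicCompletion K)) γ :=
  Matrix.GeneralLinearGroup.ext fun _ _ => rfl

/-- Mapping an upper triangular matrix along a ring map keeps it upper triangular. [folklore] -/
theorem map_mem_standardParabolicGL {R R' : Type*} [CommRing R] [CommRing R'] (f : R →+* R')
    {γ : GL (Fin n) R} (hγ : γ ∈ standardParabolicGL R (id : Fin n → Fin n)) :
    Matrix.GeneralLinearGroup.map f γ ∈ standardParabolicGL R' (id : Fin n → Fin n) := by
  intro i j hij
  change f ((γ : Matrix (Fin n) (Fin n) R) i j) = 0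
  rw [hγ hij, map_zero]

/-- **`B(K) ↪ H_S`**: the principal upper triangular elements lie in `H_S` (for every `S`).
[cite: Harder1987, §2] -/
theorem globalEmbedding_mem_borelAwayFrom {γ : GL (Fin n) K}
    (hγ : γ ∈ standardParabolicGL K (id : Fin n → Fin n)) (S : Set (HeightOneSpectrum (𝓞 K))) :
    globalEmbedding n K γ ∈ borelAwayFrom S :=
  mem_borelAwayFrom_iff.2 fun v _ => by
    rw [localComponent_globalEmbedding]
    exact map_mem_standardParabolicGL _ hγ

/-- A local element at `v` lies in `H_S` as soon as it is upper triangular or `v ∈ S`. [folklore] -/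
theorem ofLocal_mem_borelAwayFrom {S : Set (HeightOneSpectrum (𝓞 K))} {v : HeightOneSpectrum (𝓞 K)}
    {g : GL (Fin n) (v.adicCompletion K)}
    (hg : v ∉ S → g ∈ standardParabolicGL (v.adicCompletion K) (id : Fin n → Fin n)) :
    ofLocal n K v g ∈ borelAwayFrom S :=
  mem_borelAwayFrom_iff.2 fun w hw => by
    by_cases hwv : w = v
    · subst hwv
      rw [localComponent_ofLocal]
      exact hg hw
    · rw [localComponent_ofLocal_of_ne hwv]
      exact one_mem _

/-- Local components of an upper triangular adelic matrix are upper triangular. [folklore] -/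
theorem localComponent_mem_standardParabolicGL_of_blockTriangular {b : FiniteAdelicGL n K}
    (hb : (b : Matrix (Fin n) (Fin n) (FiniteAdeleRing (𝓞 K) K)).BlockTriangular id)
    (v : HeightOneSpectrum (𝓞 K)) :
    localComponent n K v b ∈ standardParabolicGL (v.adicCompletion K) (id : Fin n → Fin n) := by
  intro i j hij
  rw [coe_localComponent_apply, hb hij]
  rfl

/-- **`B(𝔸_K^∞) ≤ H_S`.** [folklore] -/
theorem mem_borelAwayFrom_of_blockTriangular {b : FiniteAdelicGL n K}
    (hb : (b : Matrix (Fin n) (Fin n) (FiniteAdeleRing (𝓞 K) K)).BlockTriangular id)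
    (S : Set (HeightOneSpectrum (𝓞 K))) : b ∈ borelAwayFrom S :=
  mem_borelAwayFrom_iff.2 fun v _ => localComponent_mem_standardParabolicGL_of_blockTriangular hb v

/-! ### `H_S · U = 𝒢` -/

/-- The part of an integral element away from `S`: local components `k_v` for `v ∉ S` and `1`
for `v ∈ S`. [folklore] -/
def awayPart (S : Set (HeightOneSpectrum (𝓞 K))) {k : FiniteAdelicGL n K}
    (hk : k ∈ glFiniteIntegralLevel n K) : FiniteAdelicGL n K := by
  classical
  exact finiteGLOf K n (fun v => if v ∈ S then 1 else localComponent n K v k)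
    (Filter.Eventually.of_forall fun v i j => by
      by_cases hv : v ∈ S
      · simp only [hv, if_true, inv_one, Units.val_one]
        constructor <;>
        · rw [Matrix.one_apply]
          split_ifs
          · exact one_mem _
          · exact zero_mem _
      · simp only [hv, if_false, ← map_inv]
        obtain ⟨h₁, h₂⟩ := mem_glFiniteIntegralLevel_iff.1 hk
        exact ⟨mem_integralFiniteAdeles_iff.1 (h₁ i j) v, mem_integralFiniteAdeles_iff.1 (h₂ i j) v⟩)

/-- Local components of `awayPart`. [folklore] -/
theorem localComponent_awayPart (S : Set (HeightOneSpectrum (𝓞 K))) {k : FiniteAdelicGL n K}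
    (hk : k ∈ glFiniteIntegralLevel n K) (v : HeightOneSpectrum (𝓞 K)) :
    localComponent n K v (awayPart S hk) =
      (by classical exact if v ∈ S then 1 else localComponent n K v k) := by
  unfold awayPart localComponent
  exact map_finiteAdeleEval_finiteGLOf _ _ v

/-- `awayPart` at `v ∈ S` is trivial. [folklore] -/
theorem localComponent_awayPart_of_mem {S : Set (HeightOneSpectrum (𝓞 K))} {k : FiniteAdelicGL n K}
    (hk : k ∈ glFiniteIntegralLevel n K) {v : HeightOneSpectrum (𝓞 K)} (hv : v ∈ S) :
    localComponent n K v (awayPart S hk) = 1 := by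
  rw [localComponent_awayPart]
  simp [hv]

/-- `awayPart` at `v ∉ S` is `k_v`. [folklore] -/
theorem localComponent_awayPart_of_not_mem {S : Set (HeightOneSpectrum (𝓞 K))}
    {k : FiniteAdelicGL n K} (hk : k ∈ glFiniteIntegralLevel n K) {v : HeightOneSpectrum (𝓞 K)}
    (hv : v ∉ S) : localComponent n K v (awayPart S hk) = localComponent n K v k := by
  rw [localComponent_awayPart]
  simp [hv]

/-- `awayPart` is integral. [folklore] -/
theorem awayPart_mem_glFiniteIntegralLevel (S : Set (HeightOneSpectrum (𝓞 K)))
    {k : FiniteAdelicGL n K} (hk : k ∈ glFiniteIntegralLevel n K) :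
    awayPart S hk ∈ glFiniteIntegralLevel n K := by
  refine mem_glFiniteIntegralLevel_of_localComponent fun w => ?_
  by_cases hw : w ∈ S
  · rw [localComponent_awayPart_of_mem hk hw]
    exact one_mem _
  · rw [localComponent_awayPart_of_not_mem hk hw]
    exact localComponent_mem_valuedCongruenceSubgroup_one hk w

/-- **`H_S · U = GL_n(𝔸_K^∞)`**: every `g` is `h u` with `h ∈ H_S` and `u ∈ U`, for any level `U`
containing the integral elements trivial at `S` (Iwasawa decomposition at the finite places,
[GetzHahn2024, Thm. 2.7.1], and the splitting of `GL_n(𝒪̂_K)` at `S`). [cite: Harder1987, §2] -/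
theorem exists_borelAwayFrom_mul_eq (S : Set (HeightOneSpectrum (𝓞 K)))
    {U : Subgroup (FiniteAdelicGL n K)}
    (hU : ∀ k ∈ glFiniteIntegralLevel n K, (∀ v ∈ S, localComponent n K v k = 1) → k ∈ U)
    (g : FiniteAdelicGL n K) :
    ∃ h : borelAwayFrom (n := n) S, ∃ u ∈ U, g = (h : FiniteAdelicGL n K) * u := by
  obtain ⟨b, k, hb, hk, rfl⟩ := exists_blockTriangular_mul_mem_glFiniteIntegralLevel g
  have hkS : awayPart S hk ∈ U := hU _ (awayPart_mem_glFiniteIntegralLevel S hk)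
    fun v hv => localComponent_awayPart_of_mem hk hv
  have hh : b * k * (awayPart S hk)⁻¹ ∈ borelAwayFrom S := by
    refine mem_borelAwayFrom_iff.2 fun v hv => ?_
    rw [map_mul, map_mul, map_inv, localComponent_awayPart_of_not_mem hk hv, mul_inv_cancel_right]
    exact localComponent_mem_standardParabolicGL_of_blockTriangular hb v
  exact ⟨⟨_, hh⟩, awayPart S hk, hkS, by rw [inv_mul_cancel_right]⟩

/-- The same, in the form used by `TwistedQuotientSubgroupModel` (`∃ h : H, ∃ l ∈ L, g = h * l`).
[folklore] -/
theorem forall_exists_borelAwayFrom_mul (S : Set (HeightOneSpectrum (𝓞 K)))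
    {U : Subgroup (FiniteAdelicGL n K)}
    (hU : ∀ k ∈ glFiniteIntegralLevel n K, (∀ v ∈ S, localComponent n K v k = 1) → k ∈ U) :
    ∀ g : FiniteAdelicGL n K, ∃ h : borelAwayFrom (n := n) S, ∃ u ∈ U,
      g = (h : FiniteAdelicGL n K) * u :=
  exists_borelAwayFrom_mul_eq S hU

/-! ### `H_S` is unramified at the good places, for the local Borel -/

section Place

variable (S : Set (HeightOneSpectrum (𝓞 K))) (w : HeightOneSpectrum (𝓞 K))

/-- `(·)_w : H_S → B(K_w)` at a place `w ∉ S`. [folklore] -/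
def toBorelLocal (hw : w ∉ S) :
    borelAwayFrom (n := n) S →* standardParabolicGL (w.adicCompletion K) (id : Fin n → Fin n) :=
  ((localComponent n K w).comp (borelAwayFrom S).subtype).codRestrict _ fun x =>
    (mem_borelAwayFrom_iff.1 x.2) w hw

/-- `ι_w : B(K_w) → H_S`. [folklore] -/
def ofBorelLocal :
    standardParabolicGL (w.adicCompletion K) (id : Fin n → Fin n) →* borelAwayFrom (n := n) S :=
  ((ofLocal n K w).comp (standardParabolicGL (w.adicCompletion K) (id : Fin n → Fin n)).subtype).codRestrict
    _ fun y => ofLocal_mem_borelAwayFrom fun _ => y.2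

variable {S w}

/-- Unfolding lemma. [folklore] -/
@[simp]
theorem coe_toBorelLocal (hw : w ∉ S) (x : borelAwayFrom (n := n) S) :
    ((toBorelLocal S w hw x : standardParabolicGL (w.adicCompletion K) (id : Fin n → Fin n)) :
        GL (Fin n) (w.adicCompletion K)) = localComponent n K w (x : FiniteAdelicGL n K) := rfl

/-- Unfolding lemma. [folklore] -/
@[simp]
theorem coe_ofBorelLocal (y : standardParabolicGL (w.adicCompletion K) (id : Fin n → Fin n)) :
    ((ofBorelLocal (n := n) S w y : borelAwayFrom (n := n) S) : FiniteAdelicGL n K) =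
      ofLocal n K w (y : GL (Fin n) (w.adicCompletion K)) := rfl

/-- **`(H_S, U ∩ H_S)` is unramified at `w ∉ S` for the local Borel** `B(K_w) ⊇ B(K_w) ∩ GL_n(𝒪_w)`
whenever `U` is unramified at `w` for `GL_n(K_w) ⊇ GL_n(𝒪_w)`. [cite: Harder1987, §2] -/
theorem isUnramifiedLevel_borelAwayFrom (hw : w ∉ S) {U : Subgroup (FiniteAdelicGL n K)}
    (hU : ArithmeticQuotient.IsUnramifiedLevel
      (valuedCongruenceSubgroup (Fin n) (1 : WithZero (Multiplicative ℤ)))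
      (ofLocal n K w) (localComponent n K w) U) :
    ArithmeticQuotient.IsUnramifiedLevel
      ((valuedCongruenceSubgroup (Fin n) (1 : WithZero (Multiplicative ℤ))).subgroupOf
        (standardParabolicGL (w.adicCompletion K) (id : Fin n → Fin n)))
      (ofBorelLocal (n := n) S w) (toBorelLocal S w hw) (U.subgroupOf (borelAwayFrom S)) where
  apply_apply y := Subtype.ext (by
    rw [coe_toBorelLocal, coe_ofBorelLocal, localComponent_ofLocal])
  comm_of_apply_eq_one x hx y := Subtype.ext (by
    have hx' : localComponent n K w (x : FiniteAdelicGL n K) = 1 := by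
      rw [← coe_toBorelLocal hw x, hx]
      rfl
    change (x : FiniteAdelicGL n K) * ofLocal n K w (y : GL (Fin n) (w.adicCompletion K)) =
      ofLocal n K w (y : GL (Fin n) (w.adicCompletion K)) * x
    exact mul_ofLocal_comm hx' _)
  map_le := by
    rintro _ ⟨y, hy, rfl⟩
    rw [Subgroup.mem_subgroupOf, coe_ofBorelLocal]
    exact hU.map_le ⟨y, Subgroup.mem_subgroupOf.1 hy, rfl⟩
  le_comap := by
    intro x hx
    rw [Subgroup.mem_comap, Subgroup.mem_subgroupOf, coe_toBorelLocal]
    exact hU.le_comap (Subgroup.mem_subgroupOf.1 hx)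

end Place

end BigHeckeGLn

end Literature.NumberTheory.Automorphic
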